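import Summits.Ventures.Crystal3D.Theorems.StickyWulffConstantGenericWallFloorBarlowFamiliesApart
import Summits.Ventures.Crystal3D.Theorems.StickyWulffConstantGenericWallFloorBarlowWindowTiltWide
import Summits.Ventures.Crystal3D.Theorems.StickyWulffConstantGenericWallFloorBarlowCoreAvoidTiltWide
import HarnessLib

/-!
# The STEERED bottom zigzag window family, WIDE tilt (‖z − e₃‖ ≤ 1/3, constant of record): `bottomFamily_spec_apart_tiltWide`
# (K1b / EDGE-ON option (ε), WIDE brick 4; lane T crux `TextureLiminfV5`, stmt-Ventures-23912, sub-crux EDGE-ON `stub_edgeOn`; HOME/wall-p2-g11/EPSILON-SIZING.md)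

HONEST FRAMING. Venture `Summits/Ventures/Crystal3D` (cell `crystal3d-full`), route `route-Ventures-StickyWulffConstant`, helper `--supports` the
law-v5 crux `TextureLiminfV5` (stmt-Ventures-23912), registered line `TexShadow` v8.3, open stub `stub_edgeOn` (K4).  Rung credit only; F-C1 not moved; NOT
the stub.  Pure walk bookkeeping, standard axioms; E1 BY NAME (`hsE/hcert`).

THE POINT.  `bottomFamily_spec_apart` (…BarlowFamiliesApart, K1a) assembles the plate-1 zigzag window family for the wall-normal steering `e₃`.  This is
its TILT PORT: the walk (canonical start states, `∇`-cappers `bestCapper G (L₁ e₃) z`, chain frames `chainFrames z L₁ v₀`, validity, orbits) is steered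
by a unit `z` with ‖z − e₃‖ ≤ 1/3, the launch slot `v₀` is steep FOR `z` (`⟪L₁ v₀, z⟫ ≥ √2/2` — reachable by up-slots of `e₃`-rise ≥ 0.4354, EPSILON-SIZING
§2), while the window, the complete region and the payer window stay in `e₃`-HEIGHTS; the in-plate steps rise `≥ δ` in `e₃` (`hδ`, engine-certified per
box; ≥ 1/8 is automatic from the tilt but we keep the hypothesis form of K1a).  Bricks used: `canon_start_valid` (z-general), `windowFamily_walkRun_injOn_tiltWide` /
`windowStart_end_refHeight_gt_wide` (e = e₃), `walkEnd_mem_PAY_apart_tiltWide` (lateral budget `24(h + 4R₀)`, fuel `24(h + 4R₀) < N`).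
* **`bottomFamily_spec_apart_tiltWide`** (= `bottomFamily_spec_apart_tilt` p697407 with 1/3, budgets ×3) — every start state satisfies `WalkInv X z` ∧ `StackWF z`, has bottom entry `⟨L₁, v₀, 0⟩` and a `WalkCertified12`
  top, its walk ends in lane T's payer window `{deg ≠ 12, −R₀ − 2 ≤ y₂ ≤ h + R₀ + 2}` within `N` steps, and the family is end-injective.
  (The `z`-height fuel clause of the two-family count is left to the count file, which knows `ρ`.)
WHAT THIS IS NOT: not the count / lines / glue (bricks 5), not the top family; F-C1 not moved.
-/

noncomputable section

namespace Summit.Ventures.Crystal3D.Theorems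

open Finset
open Literature.MathematicalPhysics.StatisticalMechanics
open Summit.Ventures.Crystal3D.Cruxes.TextureLiminf.TexShadow (stacking)
open scoped InnerProductSpace

variable {X : Finset (EuclideanSpace ℝ (Fin 3))}

section Cell

variable (σ₁ : ℤ → ℤ) (L₁ : EuclideanSpace ℝ (Fin 3) ≃ₗᵢ[ℝ] EuclideanSpace ℝ (Fin 3)) (s₀ z v₀ : EuclideanSpace ℝ (Fin 3))
  (canon : ℤ → EuclideanSpace ℝ (Fin 3) → EuclideanSpace ℝ (Fin 3) × List WalkEntry) (ms : ℤ → EuclideanSpace ℝ (Fin 3))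

open scoped Classical in
/-- **The steered bottom family, frames apart from the top plate, delivers the inputs of the frame-separated count.**  See the module docstring. -/
theorem bottomFamily_spec_apart_tiltWide (hσ₁ : IsHaggSeq σ₁) (hX : ∀ p ∈ X, ∀ q ∈ X, p ≠ q → 1 ≤ dist p q)
    {sE : EuclideanSpace ℝ (Fin 3)} (hsE : sE ∈ fccSlots) (hcert : ExactOnly 0 (fccSlots.filter fun w => 0 < ⟪w, sE⟫_ℝ))
    -- the cell
    {σ₂ : ℤ → ℤ} (hσ₂ : IsHaggSeq σ₂) (L₂ : EuclideanSpace ℝ (Fin 3) ≃ₗᵢ[ℝ] EuclideanSpace ℝ (Fin 3)) (s₂ : EuclideanSpace ℝ (Fin 3))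
    (R₀ h ρ : ℝ) (hR₀ : 6 ≤ R₀) (hh : 0 ≤ h) (hρ : 1 ≤ ρ) (P₁ P₂ : Finset (EuclideanSpace ℝ (Fin 3))) (hP₁X : P₁ ⊆ X) (hP₂X : P₂ ⊆ X)
    (hcell : ∀ p ∈ X, -(2 * R₀) ≤ p 2 ∧ p 2 ≤ h + 2 * R₀ ∧ p 0 ^ 2 + p 1 ^ 2 ≤ ρ ^ 2)
    (hP₁ : ∀ p, p ∈ P₁ ↔ (p ∈ stacking L₁ s₀ σ₁ ∧ -(2 * R₀) ≤ p 2 ∧ p 2 ≤ -R₀ ∧ p 0 ^ 2 + p 1 ^ 2 ≤ ρ ^ 2))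
    (hP₂ : ∀ p, p ∈ P₂ ↔ (p ∈ stacking L₂ s₂ σ₂ ∧ h + R₀ ≤ p 2 ∧ p 2 ≤ h + 2 * R₀ ∧ p 0 ^ 2 + p 1 ^ 2 ≤ ρ ^ 2))
    -- the steering and the walk data
    (hz : ‖z‖ = 1) (hze : ‖z - EuclideanSpace.single (2 : Fin 3) (1 : ℝ)‖ ≤ 1 / 3)
    (hv₀ : v₀ ∈ fccSlots) (hv₀2 : v₀ 2 = Real.sqrt (2 / 3))
    (hsteep : Real.sqrt 2 / 2 ≤ ⟪L₁ v₀, z⟫_ℝ)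
    (hcanon₁ : ∀ m t, σ₁ (m - 1) = 1 → canon m t = (t, [⟨L₁, v₀, 0⟩]))
    (hcanon₂ : ∀ m t, σ₁ (m - 1) = -1 → canon m t =
      (t, [⟨twinFrame L₁ (L₁ (EuclideanSpace.single (2 : Fin 3) (1 : ℝ))),
            bestCapper (twinFrame L₁ (L₁ (EuclideanSpace.single (2 : Fin 3) (1 : ℝ)))) (L₁ (EuclideanSpace.single (2 : Fin 3) (1 : ℝ))) z,
            L₁ (EuclideanSpace.single (2 : Fin 3) (1 : ℝ))⟩, ⟨L₁, v₀, 0⟩]))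
    (hms₁ : ∀ m, σ₁ m = 1 → ms m = v₀)
    (hms₂ : ∀ m, σ₁ m = -1 → ms m =
      basalMirror (bestCapper (twinFrame L₁ (L₁ (EuclideanSpace.single (2 : Fin 3) (1 : ℝ)))) (L₁ (EuclideanSpace.single (2 : Fin 3) (1 : ℝ))) z))
    {δ : ℝ} (hδ0 : 0 < δ) (hδ : ∀ m, δ ≤ ⟪L₁ (ms m), EuclideanSpace.single (2 : Fin 3) (1 : ℝ)⟫_ℝ)
    -- frames apart from the top plate
    (hapart : ∀ F ∈ chainFrames z L₁ v₀,
      F '' fccStacking 1 (Real.sqrt (2 / 3)) ≠ L₂ '' fccStacking 1 (Real.sqrt (2 / 3)) ∧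
      F '' fccStacking 1 (Real.sqrt (2 / 3)) ≠
        (twinFrame L₂ (L₂ (EuclideanSpace.single (2 : Fin 3) (1 : ℝ)))) '' fccStacking 1 (Real.sqrt (2 / 3)))
    -- the family
    (H ρin : ℝ) (hHlo : -(2 * R₀) + 2 ≤ H) (hHhi : H ≤ -R₀ - 3)
    (hρin : ρin + 24 * (h + 4 * R₀) + ((-R₀ - 2 - H) / δ + 2) ≤ ρ - 1)
    {ι : Type*} (T : Finset ι) (mi ai bi : ι → ℤ)
    (hlow : ∀ i ∈ T, H ≤ ⟪L₁ (barlowPos 1 (Real.sqrt (2 / 3)) σ₁ (mi i) (ai i) (bi i)) + s₀, EuclideanSpace.single (2 : Fin 3) (1 : ℝ)⟫_ℝ)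
    (hpred : ∀ i ∈ T, ⟪L₁ (barlowPos 1 (Real.sqrt (2 / 3)) σ₁ (mi i) (ai i) (bi i) - ms (mi i - 1)) + s₀,
      EuclideanSpace.single (2 : Fin 3) (1 : ℝ)⟫_ℝ < H)
    (hinjT : ∀ i ∈ T, ∀ j ∈ T,
      barlowPos 1 (Real.sqrt (2 / 3)) σ₁ (mi i) (ai i) (bi i) = barlowPos 1 (Real.sqrt (2 / 3)) σ₁ (mi j) (ai j) (bi j) → i = j)
    (hlat : ∀ i ∈ T, Real.sqrt ((L₁ (barlowPos 1 (Real.sqrt (2 / 3)) σ₁ (mi i) (ai i) (bi i)) + s₀) 0 ^ 2 +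
      (L₁ (barlowPos 1 (Real.sqrt (2 / 3)) σ₁ (mi i) (ai i) (bi i)) + s₀) 1 ^ 2) ≤ ρin)
    -- fuel
    {N : ℕ} (hN1 : ⌈(-R₀ - 2 - H) / δ⌉₊ + 1 ≤ N) (hN2 : 24 * (h + 4 * R₀) < (N : ℝ)) :
    (∀ i ∈ T,
      WalkInv X z (canon (mi i) (L₁ (barlowPos 1 (Real.sqrt (2 / 3)) σ₁ (mi i) (ai i) (bi i)) + s₀)) ∧
      StackWF z (canon (mi i) (L₁ (barlowPos 1 (Real.sqrt (2 / 3)) σ₁ (mi i) (ai i) (bi i)) + s₀)).2 ∧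
      (canon (mi i) (L₁ (barlowPos 1 (Real.sqrt (2 / 3)) σ₁ (mi i) (ai i) (bi i)) + s₀)).2.getLast? = some ⟨L₁, v₀, 0⟩ ∧
      (∃ e rest, (canon (mi i) (L₁ (barlowPos 1 (Real.sqrt (2 / 3)) σ₁ (mi i) (ai i) (bi i)) + s₀)).2 = e :: rest ∧
        WalkCertified12 X (canon (mi i) (L₁ (barlowPos 1 (Real.sqrt (2 / 3)) σ₁ (mi i) (ai i) (bi i)) + s₀)).1 e) ∧
      (walkRun X z N (canon (mi i) (L₁ (barlowPos 1 (Real.sqrt (2 / 3)) σ₁ (mi i) (ai i) (bi i)) + s₀))).1 ∈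
        X.filter (fun y => (X.filter fun q => dist y q = 1).card ≠ 12 ∧ -R₀ - 2 ≤ y 2 ∧ y 2 ≤ h + R₀ + 2)) ∧
    (∀ i ∈ T, ∀ j ∈ T,
      walkRun X z N (canon (mi i) (L₁ (barlowPos 1 (Real.sqrt (2 / 3)) σ₁ (mi i) (ai i) (bi i)) + s₀)) =
        walkRun X z N (canon (mi j) (L₁ (barlowPos 1 (Real.sqrt (2 / 3)) σ₁ (mi j) (ai j) (bi j)) + s₀)) → i = j) := by
  set e₃ : EuclideanSpace ℝ (Fin 3) := EuclideanSpace.single (2 : Fin 3) (1 : ℝ) with he₃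
  have he₃n : ‖e₃‖ = 1 := by rw [he₃, PiLp.norm_single, norm_one]
  have he₃i : ∀ d : EuclideanSpace ℝ (Fin 3), ⟪d, e₃⟫_ℝ = d 2 := fun d => by
    rw [he₃, EuclideanSpace.inner_single_right]; simp
  set bp : ℤ → ℤ → ℤ → EuclideanSpace ℝ (Fin 3) := fun m a b => barlowPos 1 (Real.sqrt (2 / 3)) σ₁ m a b with hbp
  set Ztop : ℝ := -R₀ - 2 with hZtop
  set D : ℝ := (Ztop - H) / δ + 1 with hD
  have hDdef : D = (-R₀ - 2 - H) / δ + 1 := by rw [hD, hZtop]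
  have hD0 : 0 ≤ D := by rw [hDdef]; have : 0 ≤ (-R₀ - 2 - H) / δ := div_nonneg (by linarith) hδ0.le; linarith
  -- the deep region and its two properties
  set R : Set (EuclideanSpace ℝ (Fin 3)) := {p | -(2 * R₀) + 1 ≤ (L₁ p + s₀) 2 ∧ (L₁ p + s₀) 2 ≤ -R₀ - 1 ∧
    (L₁ p + s₀) 0 ^ 2 + (L₁ p + s₀) 1 ^ 2 ≤ (ρ - 1) ^ 2} with hRdef
  have hR : ∀ m i j : ℤ, bp m i j ∈ R → ∀ q ∈ barlowStacking 1 (Real.sqrt (2 / 3)) σ₁, dist q (bp m i j) ≤ 1 → L₁ q + s₀ ∈ X :=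
    fun m i j hm => barlowWindow_complete L₁ s₀ R₀ ρ hρ P₁ hP₁X hP₁ m i j hm.1 hm.2.1 hm.2.2
  have hRin : ∀ i ∈ T, ∀ m a b : ℤ, H ≤ ⟪L₁ (bp m a b) + s₀, e₃⟫_ℝ → ⟪L₁ (bp m a b) + s₀, e₃⟫_ℝ ≤ Ztop →
      ‖bp m a b - bp (mi i) (ai i) (bi i)‖ ≤ (Ztop - H) / δ + 1 → bp m a b ∈ R := by
    intro i hi m a b h1 h2 h3
    exact barlowWindow_hRin L₁ s₀ R₀ ρ ρin ((Ztop - H) / δ + 1) H Ztop (by linarith) (by rw [hZtop]; linarith) (by rw [← hD, hDdef]; nlinarith)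
      _ _ (hlat i hi) h1 h2 h3
  -- positions of canonical states
  have hpos : ∀ m t, (canon m t).1 = t := by
    intro m t
    rcases hσ₁ (m - 1) with hm | hm
    · rw [hcanon₁ m t hm]
    · rw [hcanon₂ m t hm]
  have hlast : ∀ m t, (canon m t).2.getLast? = some ⟨L₁, v₀, 0⟩ := by
    intro m t
    rcases hσ₁ (m - 1) with hm | hm
    · rw [hcanon₁ m t hm]; rfl
    · rw [hcanon₂ m t hm]; rfl
  have hms : ∀ m, ‖ms m‖ = 1 := by
    intro m
    rcases hσ₁ m with hm | hm
    · rw [hms₁ m hm, norm_eq_one_of_mem_fccSlots hv₀]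
    · rw [hms₂ m hm, LinearIsometryEquiv.norm_map, norm_eq_one_of_mem_fccSlots (bestCapper_nabla_slot L₁ z).1]
  -- validity of every start (complete predecessor dozen)
  have hvalid : ∀ i ∈ T, WalkInv X z (canon (mi i) (L₁ (bp (mi i) (ai i) (bi i)) + s₀)) ∧
      StackWF z (canon (mi i) (L₁ (bp (mi i) (ai i) (bi i)) + s₀)).2 ∧
      ∃ e rest, (canon (mi i) (L₁ (bp (mi i) (ai i) (bi i)) + s₀)).2 = e :: rest ∧
        WalkCertified12 X (canon (mi i) (L₁ (bp (mi i) (ai i) (bi i)) + s₀)).1 e := by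
    intro i hi
    obtain ⟨a', b', hab⟩ := pred_mem_barlowLayer σ₁ hσ₁ L₁ z v₀ ms hv₀ hv₀2 hms₁ hms₂ (mi i) (ai i) (bi i)
    -- the predecessor is deep
    have hpredeq : bp (mi i - 1) a' b' + ms (mi i - 1) = bp (mi i) (ai i) (bi i) := by
      show barlowPos 1 (Real.sqrt (2 / 3)) σ₁ (mi i - 1) a' b' + ms (mi i - 1) = barlowPos 1 (Real.sqrt (2 / 3)) σ₁ (mi i) (ai i) (bi i)
      rw [← hab, sub_add_cancel]
    have hph : ⟪L₁ (bp (mi i - 1) a' b') + s₀, e₃⟫_ℝ < H := by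
      have := hpred i hi; rw [hab] at this; exact this
    have hpl : H - 1 ≤ ⟪L₁ (bp (mi i - 1) a' b') + s₀, e₃⟫_ℝ := by
      have h1 := height_step_le L₁ s₀ e₃ ms he₃n hms (bp (mi i - 1) a' b') (mi i - 1)
      rw [hpredeq] at h1
      have h2 := hlow i hi
      linarith
    have hplat : Real.sqrt ((L₁ (bp (mi i - 1) a' b') + s₀) 0 ^ 2 + (L₁ (bp (mi i - 1) a' b') + s₀) 1 ^ 2) ≤ ρin + 1 := by
      have h1 := lateral_radius_le_add_dist (L₁ (bp (mi i - 1) a' b') + s₀) (L₁ (bp (mi i) (ai i) (bi i)) + s₀)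
      have h2 : dist (L₁ (bp (mi i - 1) a' b') + s₀) (L₁ (bp (mi i) (ai i) (bi i)) + s₀) ≤ 1 := by
        rw [dist_eq_norm, show L₁ (bp (mi i - 1) a' b') + s₀ - (L₁ (bp (mi i) (ai i) (bi i)) + s₀) =
          L₁ (bp (mi i - 1) a' b') - L₁ (bp (mi i) (ai i) (bi i)) by abel, ← map_sub, LinearIsometryEquiv.norm_map,
          ← hpredeq, show bp (mi i - 1) a' b' - (bp (mi i - 1) a' b' + ms (mi i - 1)) = -ms (mi i - 1) by abel, norm_neg, hms]
      have h3 := hlat i hi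
      linarith
    have hXpred : ∀ q ∈ barlowStacking 1 (Real.sqrt (2 / 3)) σ₁, dist q (bp (mi i - 1) a' b') ≤ 1 → L₁ q + s₀ ∈ X := by
      refine hR (mi i - 1) a' b' ⟨?_, ?_, ?_⟩
      · rw [← he₃i]; linarith
      · rw [← he₃i]; linarith
      · have h0 : 0 ≤ (L₁ (bp (mi i - 1) a' b') + s₀) 0 ^ 2 + (L₁ (bp (mi i - 1) a' b') + s₀) 1 ^ 2 := by positivity
        have hr : Real.sqrt ((L₁ (bp (mi i - 1) a' b') + s₀) 0 ^ 2 + (L₁ (bp (mi i - 1) a' b') + s₀) 1 ^ 2) ≤ ρ - 1 := by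
          have hRh : 0 ≤ h + 4 * R₀ := by linarith
          nlinarith [hplat, hρin, hD0, hh]
        have h7 := pow_le_pow_left₀ (Real.sqrt_nonneg _) hr 2
        rwa [Real.sq_sqrt h0] at h7
    have key := canon_start_valid (σ := σ₁) (L := L₁) (s₀ := s₀) (z := z) (v₀ := v₀) (canon := canon) (ms := ms)
      hσ₁ hz hv₀ hv₀2 hsteep hcanon₁ hcanon₂ hms₁ hms₂ (k := mi i - 1) (i := a') (j := b') hXpred
    have e1 : mi i - 1 + 1 = mi i := by ring
    rw [e1] at key
    have e2 : barlowPos 1 (Real.sqrt (2 / 3)) σ₁ (mi i - 1) a' b' + ms (mi i - 1) = bp (mi i) (ai i) (bi i) := hpredeq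
    rw [e2] at key
    exact key
  -- injectivity (tilt toolkit, window in `e₃`-heights)
  have hinj := windowFamily_walkRun_injOn_tiltWide (σ := σ₁) (L := L₁) (s₀ := s₀) (z := z) (v₀ := v₀) (ms := ms) (canon := canon)
    hσ₁ hX hsE hcert he₃n hz hze hv₀ hv₀2 hcanon₁ hcanon₂ hms₁ hms₂ hδ0 hδ R hR H Ztop (by rw [hZtop]; linarith) T mi ai bi hRin hlow hpred
    hinjT (fun i hi => ⟨(hvalid i hi).1, (hvalid i hi).2.1⟩) N
  refine ⟨fun i hi => ?_, hinj⟩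
  obtain ⟨hI, hW, hC⟩ := hvalid i hi
  have hstart2 : -(2 * R₀) ≤ (canon (mi i) (L₁ (bp (mi i) (ai i) (bi i)) + s₀)).1 2 := (hcell _ hI.1).1
  have hfuel : 24 * (h + 2 * R₀ - (canon (mi i) (L₁ (bp (mi i) (ai i) (bi i)) + s₀)).1 2) < N := by linarith
  -- not low
  have hgt := windowStart_end_refHeight_gt_wide (σ := σ₁) (L := L₁) (s₀ := s₀) (z := z) (v₀ := v₀) (canon := canon) (ms := ms)
    hσ₁ hX hsE hcert hz hze hv₀ hv₀2 hcanon₁ hcanon₂ hms₁ hms₂ hδ0 hδ R hR H Ztop (by rw [hZtop]; linarith) (mi i) (ai i) (bi i)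
    (hRin i hi) (hlow i hi) ⟨hI, hW⟩ (N := N) (by rw [hZtop]; exact hN1)
  have hlow' : -R₀ - 2 ≤ (walkRun X z N (canon (mi i) (L₁ (bp (mi i) (ai i) (bi i)) + s₀))).1 2 := by
    rw [← he₃i]; rw [hZtop] at hgt; exact hgt.le
  -- frames of the stacks, lateral margin, then «not high» by core avoidance (tilt form)
  have hM₁ : ∀ stk : List WalkEntry, StackSound z stk → StackWF z stk → stk.getLast? = some ⟨L₁, v₀, 0⟩ →
      ∀ e ∈ stk, e.frame ∈ chainFrames z L₁ v₀ := fun stk hS hWF hl => frame_mem_chainFrames_of_stack hS hWF hl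
  have hlat' : Real.sqrt ((canon (mi i) (L₁ (bp (mi i) (ai i) (bi i)) + s₀)).1 0 ^ 2 +
      (canon (mi i) (L₁ (bp (mi i) (ai i) (bi i)) + s₀)).1 1 ^ 2) + 24 * (h + 4 * R₀) ≤ ρ - 2 := by
    rw [hpos]; have := hlat i hi
    have hfrac : 0 ≤ (-R₀ - 2 - H) / δ := div_nonneg (by linarith) hδ0.le
    linarith
  have hρ2 : 2 ≤ ρ := by
    have h1 := hlat i hi
    have h2 := Real.sqrt_nonneg ((L₁ (bp (mi i) (ai i) (bi i)) + s₀) 0 ^ 2 + (L₁ (bp (mi i) (ai i) (bi i)) + s₀) 1 ^ 2)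
    have hfrac : 0 ≤ (-R₀ - 2 - H) / δ := div_nonneg (by linarith) hδ0.le
    have hRh : 0 ≤ h + 4 * R₀ := by linarith
    linarith
  have hPAY := walkEnd_mem_PAY_apart_tiltWide hX hsE hcert hσ₂ L₂ s₂ R₀ h ρ hρ2 P₂ hP₂X hcell hP₂ (chainFrames z L₁ v₀) hz hze hM₁ hapart hI hW
    (hlast _ _) hlat' hfuel hlow'
  exact ⟨hI, hW, hlast _ _, hC, hPAY⟩

end Cell

end Summit.Ventures.Crystal3D.Theorems

end
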